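import Literature.AlgebraicGeometry.ModuliOfAbelianVarieties.SiegelFramedCovariant
import Literature.AlgebraicGeometry.AbelianSchemes.PolarizedLevelFrameEmbedding
import HarnessLib

/-!
# A linear rigidification embeds the abelian scheme as a CLOSED subscheme of `𝐏(J; T)` — hence `X → T` is projective

Layer `Literature/AlgebraicGeometry/ModuliOfAbelianVarieties`, namespace
`Literature.AlgebraicGeometry.AbelianSchemes.PolarizedAbelianSchemeWithLevel`.  THEOREMS ONLY (no definition, no named fact,
no instance, no notation, no `sorry`).  Cell `hodgecm-mathlib` (D-0151), F-DAG row F-8, generic brick (F4) of the F-12 census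
`B-provers/B-p11/g18/CENSUS-F12-AssemblyModuloCores.B-p11g18.md` (B-p11 (g18)); consumers: the slice-projectivity binder `hprojV`
of (8ε) FILE 2B `SiegelFineModuliSchemeOfFrameSlices` (B-p08 (g13)) and step (R4∃)(a) of (H-rep) (B-p18 (g19)).  Count-neutral
capital: HC_CM is proved only modulo the 7 printed citations until rung 0 closes — nothing here bears on a summit statement.

[MumfordFogartyKirwan1994] Ch. 7 §2 Def. 7.5 (p. 130) / Prop. 7.6 (p. 136), proof of Thm. 7.9 (p. 139): a linear rigidification
`𝒪_T^{m+1} ≅ π_*(L^Δ(λ)³)` of a polarised abelian scheme `(X/T, λ)` «determines an embedding `X ⊂ ℙ^m × T`» — a CLOSED immersion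
over `T` (fibrewise it is the projectively normal embedding by `L^Δ(λ)³`, [MumfordAV1970] §17), so `X → T` is a projective
morphism ([Hartshorne1977] II §4 Def. p. 103).  In the tree's letters (★ (8α) `IsFrameRigidification` / `IsLinearRigidification`,
which record only the `𝐏^m_ℤ`-component `ι : X → 𝐏^m_ℤ` of the embedding):

* §1 `IsFrameRigidification.isClosedImmersion_lift` — for a GLOBAL frame rigidification `ι`, the `T`-morphism
  `(π, ι) : X → 𝐏(J; T) = T × 𝐏^m_ℤ` is a closed immersion (★ (FS-b)
  `Polarization.isClosedImmersion_pointOfSections_of_frame_LDelta_three`, read through the defining `homEquiv` equation).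
* §2 `IsLinearRigidification.isClosedImmersion_lift` — the same for a LINEAR rigidification (frames only Zariski-locally on `T`):
  closed immersions are Zariski-local on the target (Mathlib `IsZariskiLocalAtTarget.of_openCover`) and `𝐏(J; 𝒰ᵢ) = 𝐏(J; T) ×_T 𝒰ᵢ`
  (★ `isPullback_projectiveSpaceMap` / Mathlib `pullbackRightPullbackFstIso`); `isClosedImmersion_homEquiv_symm` — the same morphism
  spelled `(homEquiv _).symm ι`.
* §3 **`IsLinearRigidification.isProjective`** — hence `X → T` is projective (★ `Morphisms.IsProjective`, Hartshorne's definition).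

## References
* [MumfordFogartyKirwan1994] D. Mumford, J. Fogarty, F. Kirwan, *Geometric Invariant Theory*, 3rd ed. (1994), Ch. 7 §2 Def. 7.5
  (p. 130), Prop. 7.6 (p. 136); §3 proof of Thm. 7.9 (p. 139).
* [Hartshorne1977] R. Hartshorne, *Algebraic Geometry* (1977), II §4 Definition p. 103 (projective morphism); II Thm. 7.1.
* [GortzWedhorn2020] U. Görtz, T. Wedhorn, *Algebraic Geometry I: Schemes*, 2nd ed. (2020), Section (4.12) (base change of `ℙⁿ_S`).
-/

noncomputable section

-- Mathlib's `Over`/pull-back API is stated across semireducible wrappers (as in ★ `SiegelFramedCovariant`).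
set_option backward.isDefEq.respectTransparency false

open CategoryTheory CategoryTheory.Limits AlgebraicGeometry TopologicalSpace
open Literature.AlgebraicGeometry.Morphisms
open Literature.AlgebraicGeometry.Motives Literature.AlgebraicGeometry.Motives.GeneratingSections

namespace Literature.AlgebraicGeometry.AbelianSchemes

namespace PolarizedAbelianSchemeWithLevel

variable {g N : ℕ} {δ : Fin g → ℕ} (J : Type) {T : Scheme.{0}}

/-! ## §1 A global frame rigidification is a closed immersion into `𝐏(J; T)` -/

/-- **A FRAME RIGIDIFICATION EMBEDS `X` AS A CLOSED SUBSCHEME OF `𝐏(J; T)`**: if `ι : X → 𝐏^m_ℤ` is the morphism of a global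
frame `e : 𝒪^{#J+1} ≅ π_*(L^Δ(λ)^{⊗3})` (★ `IsFrameRigidification`), then the `T`-morphism `(π, ι) : X → 𝐏(J; T)` is a closed
immersion — ★ (FS-b) `Polarization.isClosedImmersion_pointOfSections_of_frame_LDelta_three` (fibrewise the sections embed,
[MumfordAV1970] §17; closed immersion by the fibrewise criterion for proper `X/T`), transported along the defining equation
`homEquiv (pointOfSections …) = ι`.
[cite: MumfordFogartyKirwan1994, Ch. 7 §2 Def. 7.5 (p. 130) and Prop. 7.6 (p. 136)] [cite: Hartshorne1977, II Thm. 7.1] -/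
theorem IsFrameRigidification.isClosedImmersion_lift [IsLocallyNoetherian T] (πT : T ⟶ Spec (.of ℚ))
    {P : PolarizedAbelianSchemeWithLevel g N δ T} {ι : P.A.X.left ⟶ projectiveSpaceInt J}
    (hι : P.IsFrameRigidification J ι) :
    IsClosedImmersion (pullback.lift P.A.X.hom ι (terminal.hom_ext _ _) : P.A.X.left ⟶ projectiveSpace J T) := by
  obtain ⟨Gr, hGr₁, hGr₂, F, h1, e, hcov, rfl⟩ := hι
  obtain ⟨hcov', h⟩ := AbelianSchemeOver.Polarization.isClosedImmersion_pointOfSections_of_frame_LDelta_three P.A P.D πT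
    P.pol Gr hGr₁ hGr₂ F h1 J e
  -- `pullback.lift π (homEquiv p) = ((homEquiv _).symm (homEquiv _ p)).left = p.left`
  have key : ∀ p : Over.mk P.A.X.hom ⟶ Over.mk (projectiveSpaceFst J T),
      pullback.lift P.A.X.hom (projectiveSpace.homEquiv (Over.mk P.A.X.hom) p) (terminal.hom_ext _ _) = p.left := by
    intro p
    refine pullback.hom_ext ?_ ?_
    · rw [pullback.lift_fst]
      exact (Over.w p).symm
    · rw [pullback.lift_snd]
      rfl
  rw [key]
  exact h

/-! ## §2 A linear rigidification is a closed immersion into `𝐏(J; T)` (Zariski-local on the target) -/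

/-- **A LINEAR RIGIDIFICATION EMBEDS `X` AS A CLOSED SUBSCHEME OF `𝐏(J; T)`** ([MumfordFogartyKirwan1994] Prop. 7.6 / proof of
Thm. 7.9: «the linear rigidification determines an embedding `X ⊂ ℙ^m × T`»).  The frames exist only on an open cover `𝒰` of
`T`; over each `𝒰ᵢ` the restricted morphism `X ×_T 𝒰ᵢ → 𝐏(J; 𝒰ᵢ) = 𝐏(J; T) ×_T 𝒰ᵢ` is §1's closed immersion, and closed
immersions are Zariski-local on the target.
[cite: MumfordFogartyKirwan1994, Ch. 7 §2 Def. 7.5 (p. 130), Prop. 7.6 (p. 136) and §3 proof of Thm. 7.9 (p. 139)]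
[cite: GortzWedhorn2020, Section (4.12)] -/
theorem IsLinearRigidification.isClosedImmersion_lift [IsLocallyNoetherian T] (πT : T ⟶ Spec (.of ℚ))
    {P : PolarizedAbelianSchemeWithLevel g N δ T} {ι : P.A.X.left ⟶ projectiveSpaceInt J}
    (hι : P.IsLinearRigidification J ι) :
    IsClosedImmersion (pullback.lift P.A.X.hom ι (terminal.hom_ext _ _) : P.A.X.left ⟶ projectiveSpace J T) := by
  obtain ⟨𝒰, h𝒰⟩ := hι
  set j : P.A.X.left ⟶ projectiveSpace J T := pullback.lift P.A.X.hom ι (terminal.hom_ext _ _) with hj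
  have hjfst : j ≫ projectiveSpaceFst J T = P.A.X.hom := pullback.lift_fst _ _ _
  have hjsnd : j ≫ pullback.snd _ _ = ι := pullback.lift_snd _ _ _
  -- the cover `𝐏(J; T) ×_T 𝒰ᵢ → 𝐏(J; T)`
  refine IsZariskiLocalAtTarget.of_openCover (𝒰.pullback₁ (projectiveSpaceFst J T)) fun i => ?_
  haveI : IsLocallyNoetherian (𝒰.X i) := isLocallyNoetherian_of_isOpenImmersion (𝒰.f i)
  -- §1 for the restricted triple over `𝒰ᵢ`
  have hi : IsClosedImmersion (pullback.lift (P.baseChange (𝒰.f i)).A.X.hom (pullback.fst P.A.X.hom (𝒰.f i) ≫ ι)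
      (terminal.hom_ext _ _) : (P.baseChange (𝒰.f i)).A.X.left ⟶ projectiveSpace J (𝒰.X i)) :=
    IsFrameRigidification.isClosedImmersion_lift J (𝒰.f i ≫ πT) (h𝒰 i)
  -- the comparison isomorphisms `X ×_{𝐏(J;T)} (𝐏(J;T) ×_T 𝒰ᵢ) ≅ X ×_T 𝒰ᵢ` and `𝐏(J; 𝒰ᵢ) ≅ 𝐏(J;T) ×_T 𝒰ᵢ`
  let ψ : pullback j (pullback.fst (projectiveSpaceFst J T) (𝒰.f i)) ≅ pullback P.A.X.hom (𝒰.f i) :=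
    pullbackRightPullbackFstIso (projectiveSpaceFst J T) (𝒰.f i) j ≪≫ pullback.congrHom hjfst rfl
  let φ : projectiveSpace J (𝒰.X i) ≅ pullback (projectiveSpaceFst J T) (𝒰.f i) :=
    (isPullback_projectiveSpaceMap J (𝒰.f i)).isoPullback
  have hψfst : ψ.hom ≫ pullback.fst P.A.X.hom (𝒰.f i) = pullback.fst j _ := by
    simp only [ψ, Iso.trans_hom, Category.assoc, pullback.congrHom_hom, pullback.lift_fst, Category.comp_id]
    exact pullbackRightPullbackFstIso_hom_fst _ _ _
  have hψsnd : ψ.hom ≫ pullback.snd P.A.X.hom (𝒰.f i) = pullback.snd j _ ≫ pullback.snd _ _ := by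
    simp only [ψ, Iso.trans_hom, Category.assoc, pullback.congrHom_hom, pullback.lift_snd, Category.comp_id]
    exact pullbackRightPullbackFstIso_hom_snd _ _ _
  -- the restricted morphism IS §1's, up to these isomorphisms
  have heq : Scheme.Cover.pullbackHom (𝒰.pullback₁ (projectiveSpaceFst J T)) j i =
      ψ.hom ≫ pullback.lift (P.baseChange (𝒰.f i)).A.X.hom (pullback.fst P.A.X.hom (𝒰.f i) ≫ ι)
        (terminal.hom_ext _ _) ≫ φ.hom := by
    rw [← Category.assoc, ← Iso.comp_inv_eq]
    change pullback.snd j _ ≫ φ.inv = _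
    refine pullback.hom_ext ?_ ?_
    · -- components over `𝒰ᵢ`
      show (pullback.snd j _ ≫ φ.inv) ≫ projectiveSpaceFst J (𝒰.X i) = (ψ.hom ≫ _) ≫ projectiveSpaceFst J (𝒰.X i)
      rw [Category.assoc, Category.assoc, (isPullback_projectiveSpaceMap J (𝒰.f i)).isoPullback_inv_snd]
      erw [pullback.lift_fst]
      exact hψsnd.symm
    · -- components in `𝐏^m_ℤ`
      have h1 : φ.inv ≫ pullback.snd (terminal.from (𝒰.X i)) (terminal.from (projectiveSpaceInt J)) =
          pullback.fst (projectiveSpaceFst J T) (𝒰.f i) ≫ pullback.snd _ _ := by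
        rw [← projectiveSpaceMap_snd J (𝒰.f i), ← Category.assoc,
          (isPullback_projectiveSpaceMap J (𝒰.f i)).isoPullback_inv_fst]
      have hc : pullback.snd j (pullback.fst (projectiveSpaceFst J T) (𝒰.f i)) ≫
          pullback.fst (projectiveSpaceFst J T) (𝒰.f i) = pullback.fst j _ ≫ j := pullback.condition.symm
      rw [Category.assoc, Category.assoc, pullback.lift_snd, ← Category.assoc ψ.hom, hψfst, h1, ← Category.assoc]
      show (pullback.snd j (pullback.fst (projectiveSpaceFst J T) (𝒰.f i)) ≫
          pullback.fst (projectiveSpaceFst J T) (𝒰.f i)) ≫ _ = _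
      rw [hc, Category.assoc, hjsnd]
  rw [heq]
  infer_instance

/-- The same closed immersion spelled as the `T`-point `(homEquiv _).symm ι` of `𝐏(J; T)` (the currency of ★
`projectiveSpace.pointOfSections` / `IsFrameRigidification`): its underlying morphism `X → 𝐏(J; T)` is a closed immersion.
[cite: MumfordFogartyKirwan1994, Ch. 7 §2 Def. 7.5 (p. 130) and Prop. 7.6 (p. 136)] -/
theorem IsLinearRigidification.isClosedImmersion_homEquiv_symm [IsLocallyNoetherian T] (πT : T ⟶ Spec (.of ℚ))
    {P : PolarizedAbelianSchemeWithLevel g N δ T} {ι : P.A.X.left ⟶ projectiveSpaceInt J}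
    (hι : P.IsLinearRigidification J ι) :
    IsClosedImmersion ((projectiveSpace.homEquiv (Over.mk P.A.X.hom)).symm ι).left := by
  rw [projectiveSpace.homEquiv_symm_apply_left]
  exact hι.isClosedImmersion_lift J πT

/-! ## §3 Hence `X → T` is projective -/

/-- **A LINEARLY RIGIDIFIED ABELIAN SCHEME IS PROJECTIVE OVER ITS BASE**: `X → T` factors as the closed immersion
`(π, ι) : X ↪ 𝐏(J; T)` followed by the projection — Hartshorne's definition of a projective morphism (★
`Morphisms.IsProjective`).  [MumfordFogartyKirwan1994] proof of Thm. 7.9: «`X ⊂ ℙ^m × T` … projective over `T`».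
[cite: MumfordFogartyKirwan1994, Ch. 7 §2 Prop. 7.6 (p. 136) and §3 proof of Thm. 7.9 (p. 139)]
[cite: Hartshorne1977, II §4 Definition p. 103 (projective morphism)] -/
theorem IsLinearRigidification.isProjective [IsLocallyNoetherian T] (πT : T ⟶ Spec (.of ℚ)) [Finite J]
    {P : PolarizedAbelianSchemeWithLevel g N δ T} {ι : P.A.X.left ⟶ projectiveSpaceInt J}
    (hι : P.IsLinearRigidification J ι) : Morphisms.IsProjective P.A.X.hom :=
  ⟨J, ‹Finite J›, pullback.lift P.A.X.hom ι (terminal.hom_ext _ _), hι.isClosedImmersion_lift J πT,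
    pullback.lift_fst _ _ _⟩

end PolarizedAbelianSchemeWithLevel

end Literature.AlgebraicGeometry.AbelianSchemes

end
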